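import Literature.NumberTheory.EllipticCurves.ZpExtensionEisensteinOrdinaryResidualLiftProofs
import HarnessLib

/-!
# The residual lift at a place above `p`, II: `H²(K_w, ker) = 0` by local duality and the surjectivity
# `H¹(K_w, A_{m,1} ⊗ Fil_w M₁) ↠ H¹(K_w, Fil_w T̄)` (theorems only; no definition, no named fact, no instance, no `sorry`)

Topic `NumberTheory/EllipticCurves` (D1 road of cell `pub/bsd-print-x9`; brick (C1-lift II) of seat `bsd-line-x10b-p1-w8` g2's (H5B-P)):
the hypothesis `hliftbar` of `ZpExtension.propagate_eisensteinSelmerStructure_one_eq_strictSubgroup`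
(`ZpExtensionEisensteinOrdinaryResidualStrictProofs`) from the NON-ANOMALOUS input «every `Γ_{K_w}`-equivariant additive map
`Fil_w M₁ → μ_p` vanishes» (`Fil_w E[p] ≇ μ_p`, equivalently `Ẽ_w[p]^{Γ_w} = 0` by the Weil pairing), PURITY (part I,
`ZpExtensionEisensteinOrdinaryResidualLiftProofs`: `ker π̄ ∩ (A ⊗ Fil) = [T]·(A ⊗ Fil)`) and «`π̄ (A ⊗ Fil_w M₁) = Fil_w T̄`».

Howard [B. Howard, Compositio Math. 140 (2004), Lemma 3.2.7, arXiv:1202.6340 p. 16 L150–156]: the cokernel of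
`H¹(K_v, Fil_v 𝐓) → H¹(K_v, Fil_v(T) ⊗ Λ/𝔭)` «is controlled by `H²(K_v, Fil_v 𝐓)[𝔭]`, and by local duality it suffices to bound
`H⁰(K_v, gr_v 𝐀)`» — zero in the non-anomalous case.

* §1 **`ZpExtension.OrdinaryFiltration.subsingleton_continuousCohomology_two_ker_restrict`** — `H²(K_w, K) = 0` for
  `K = {x ∈ A_{m,1} ⊗ Fil_w M₁ | π̄ x = 0}` (Hom-dévissage of part I + `natCard_two_eq_natCard_invariants_homRep` at `k = 1`).
* §2 **`ZpExtension.OrdinaryFiltration.surjective_cohomologyMap_restrict_twistedFil_one`** — `H¹(K_w, A_{m,1} ⊗ Fil_w M₁) → H¹(K_w, Fil_w T̄)`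
  is ONTO (`IsSES.exists_map_one_eq_of_δ₁_eq_zero` for `0 → K → A ⊗ Fil → Fil_w T̄ → 0`), VERBATIM the binder `hliftbar`.
* §3 `E`-level: **`WeierstrassCurve.surjective_cohomologyMap_restrict_πbar_twistedFil`** — for `M_k = E[p^k]`, `T̄ = E[p]`,
  `Fil_w T̄ = E[p] ∩ E₁(K̄_w)`, `π̄(1 ⊗ a) = a`, at a place `w ∋ p` of good reduction with an ordinary point.

No summit statement is proved; BSD is not proved by any of this.

References: [Howard2004HeegnerKolyvagin] Lemma 3.2.7, §3.1 (arXiv:1202.6340 p. 16 L150–156, p. 15 L56–66); [MilneADT2006] I Cor. 2.3;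
[SerreGaloisCohomology1997] I §2.2, II §5.2; [GreenbergLNM1716] §2.
-/

set_option autoImplicit false

noncomputable section

open Function NumberField IsDedekindDomain Field CategoryTheory
open scoped NumberField TensorProduct ContRepresentation

/-! ## §1–§2 Generic: `H²(K_w, K) = 0` and the lift -/

namespace Literature.NumberTheory.EllipticCurves.ZpExtension.OrdinaryFiltration

open Literature.NumberTheory.GaloisRepresentations Literature.NumberTheory.GaloisRepresentations.DiscreteGaloisModule
open Literature.NumberTheory.GaloisCohomology.Howard2004
open Literature.NumberTheory.EllipticCurves.IwasawaAlgebra Literature.NumberTheory.Automorphic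

variable {K : Type} [Field K] [NumberField K] {p : ℕ} [hp : Fact p.Prime] (κ : ZpExtension K p)
  {M : ℕ → Type} [∀ k, AddCommGroup (M k)] [∀ k, TopologicalSpace (M k)] [∀ k, DiscreteTopology (M k)]
  {ρ : ∀ k, DiscreteGaloisModule K (M k)}
  {t : ∀ k, (ρ (k + 1)).toContRepresentation →ⁱL (ρ k).toContRepresentation} {m : ℕ} (hm : 1 ≤ m)
  {w : HeightOneSpectrum (𝓞 K)} (Φ : OrdinaryFiltration ρ t w)
  {N : Type} [AddCommGroup N] [TopologicalSpace N] [DiscreteTopology N] [Module (EisensteinCoeff p m 1) N]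
  (hNmod : ∀ (d : EisensteinCoeff p m 1) (n : N), d • n = (EisensteinCoeff.residueChar p hm (le_refl 1) d).val • n)
  (ρN : DiscreteGaloisModule K N) (πbar : EisensteinCoeff.Twisted p m 1 (M 1) →ₗ[EisensteinCoeff p m 1] N)
  (hbar : IsQuotientBy (κ.eisensteinTwist (ρ 1) hm 1)
    (@IsLocalRing.maximalIdeal _ _ (EisensteinCoeff.isLocalRing_eisensteinCoeff p hm (le_refl 1))) ρN πbar)
  (hpure : ∀ x ∈ Φ.twistedFil (p := p) (m := m) 1, πbar x = 0 →
    ∃ y ∈ Φ.twistedFil (p := p) (m := m) 1, x = (Ideal.Quotient.mk _ PowerSeries.X : EisensteinCoeff p m 1) • y)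
  (hFil : ∀ g : Φ.fil 1 →+ MuCarrier (w.adicCompletion K) (p ^ 1),
    (∀ (σ : absoluteGaloisGroup (w.adicCompletion K)) (a : Φ.fil 1),
      g ⟨GaloisRep.toLocal w (ρ 1) σ a, Φ.smul_mem 1 σ a a.2⟩ = mu (w.adicCompletion K) (p ^ 1) σ (g a)) → g = 0)
  (K₀ : Submodule ℤ (Φ.twistedFil (p := p) (m := m) 1))
  (hK₀ : ∀ x, x ∈ K₀ ↔ πbar (x : EisensteinCoeff.Twisted p m 1 (M 1)) = 0)
  (hK₀Γ : ∀ σ : absoluteGaloisGroup (w.adicCompletion K), K₀ ≤ K₀.comap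
    (((GaloisRep.toLocal w (κ.eisensteinTwist (ρ 1) hm 1)).subrepresentation (Φ.twistedFil 1) (Φ.twistedFil_le_comap hm 1)) σ))

include hNmod hbar hpure hFil hK₀ in
/-- **`H²(K_w, K) = 0`** for the kernel `K = {x ∈ A_{m,1} ⊗ Fil_w M₁ | π̄ x = 0}` of the residual presentation restricted to the plus part,
under PURITY and the non-anomalous input «`Hom_{Γ_w}(Fil_w M₁, μ_p) = 0`»: local duality in bidegree `(2,0)` turns `H²` into the
equivariant maps `K → μ_p`, all zero by the Hom-dévissage of part I.
[cite: Howard2004HeegnerKolyvagin, Lemma 3.2.7 (arXiv:1202.6340 p. 16 L150–156)] [cite: MilneADT2006, Ch. I Cor. 2.3]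
[cite: SerreGaloisCohomology1997, Ch. II §5.2 Thm. 2] -/
theorem subsingleton_continuousCohomology_two_ker_restrict [Finite (M 1)] :
    Subsingleton (continuousCohomology 2
      ((((GaloisRep.toLocal w (κ.eisensteinTwist (ρ 1) hm 1)).subrepresentation (Φ.twistedFil 1)
        (Φ.twistedFil_le_comap hm 1)).subrepresentation K₀ hK₀Γ).toTopRep)) := by
  haveI : Finite (EisensteinCoeff.Twisted p m 1 (M 1)) := EisensteinCoeff.finite_twisted (p := p) (k := 1) hm
  haveI : CharZero (w.adicCompletion K) := charZero_of_injective_algebraMap (algebraMap K _).injective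
  set τK := ((GaloisRep.toLocal w (κ.eisensteinTwist (ρ 1) hm 1)).subrepresentation (Φ.twistedFil 1)
    (Φ.twistedFil_le_comap hm 1)).subrepresentation K₀ hK₀Γ with hτK
  have hM : ∀ x : K₀, p ^ 1 • x = 0 := fun x ↦
    Subtype.ext (Subtype.ext (by
      rw [Submodule.coe_smul_of_tower, Submodule.coe_zero, Submodule.coe_smul_of_tower, Submodule.coe_zero]
      exact EisensteinCoeff.prime_pow_nsmul_twisted (x.1 : EisensteinCoeff.Twisted p m 1 (M 1))))
  obtain ⟨hfin, hcard⟩ := natCard_two_eq_natCard_invariants_homRep (w.adicCompletion K) τK hM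
  have hinv : ∀ f : (τK.homRep (mu (w.adicCompletion K) (p ^ 1))).toTopRep.ρ.invariants, f = 0 := by
    intro f
    apply Subtype.ext
    let f₀ : K₀ →+ MuCarrier (w.adicCompletion K) (p ^ 1) := f.1
    have hf : ∀ σ, τK.homRep (mu (w.adicCompletion K) (p ^ 1)) σ f.1 = f.1 := f.2
    have heq : ∀ (σ : absoluteGaloisGroup (w.adicCompletion K)) (x : K₀),
        f₀ (τK σ x) = mu (w.adicCompletion K) (p ^ 1) σ (f₀ x) := fun σ x ↦
      (((ContinuousRep.homRep_apply_eq_self_iff τK _ σ _).mp (hf σ)) x).symm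
    have h := Φ.forall_equivariant_ker_restrict_eq_zero κ hm hNmod ρN πbar hbar hpure
      (fun σ ↦ (mu (w.adicCompletion K) (p ^ 1) σ).toAddMonoidHom) hFil K₀ hK₀ f₀
      (fun σ x hx' ↦ (congrArg f₀ (Subtype.ext rfl : (⟨_, hx'⟩ : K₀) = τK σ x)).trans (heq σ x))
    exact h
  haveI : Subsingleton (τK.homRep (mu (w.adicCompletion K) (p ^ 1))).toTopRep.ρ.invariants :=
    ⟨fun a b ↦ by rw [hinv a, hinv b]⟩
  haveI := hfin
  have h1 : Nat.card (continuousCohomology 2 τK.toTopRep) = 1 := by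
    rw [hcard]; exact Nat.card_of_subsingleton 0
  exact (Nat.card_eq_one_iff_unique.mp h1).1

include hNmod hbar hpure hFil in
/-- **The residual lift**: `H¹(K_w, A_{m,1} ⊗ Fil_w M₁) → H¹(K_w, Fil_w T̄)` (induced by `π̄`) is SURJECTIVE, in the non-anomalous case
and under PURITY, when `π̄` maps `A ⊗ Fil_w M₁` into (`hπFil`) and onto (`hπonto`) the `Γ_{K_w}`-stable `Fil_w T̄ ≤ T̄` — the long exact
sequence of `0 → K → A ⊗ Fil → Fil_w T̄ → 0` at `H¹(Fil_w T̄) →δ₁ H²(K) = 0`.  This is the binder `hliftbar` of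
`ZpExtension.propagate_eisensteinSelmerStructure_one_eq_strictSubgroup`.
[cite: Howard2004HeegnerKolyvagin, Lemma 3.2.7 (arXiv:1202.6340 p. 16 L150–156)] [cite: SerreGaloisCohomology1997, Ch. I §2.2] -/
theorem surjective_cohomologyMap_restrict_twistedFil_one [Finite (M 1)] (FilN : Submodule ℤ N)
    (hΓN : ∀ σ : absoluteGaloisGroup (w.adicCompletion K), FilN ≤ FilN.comap (GaloisRep.toLocal w ρN σ))
    (hπFil : ∀ x ∈ Φ.twistedFil (p := p) (m := m) 1, πbar x ∈ FilN)
    (hπonto : ∀ y ∈ FilN, ∃ x ∈ Φ.twistedFil (p := p) (m := m) 1, πbar x = y) :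
    Function.Surjective
      (ContinuousRep.cohomologyMap
        ((GaloisRep.toLocal w (κ.eisensteinTwist (ρ 1) hm 1)).subrepresentation (Φ.twistedFil 1) (Φ.twistedFil_le_comap hm 1))
        ((GaloisRep.toLocal w ρN).subrepresentation FilN hΓN)
        (πbar.toAddMonoidHom.toIntLinearMap.restrict (p := Φ.twistedFil (p := p) (m := m) 1) (q := FilN) hπFil).toAddMonoidHom
        continuous_of_discreteTopology
        (fun σ x ↦ Subtype.ext (hbar.equivariant (absGaloisRestrict K (w.adicCompletion K) σ)
          (x : EisensteinCoeff.Twisted p m 1 (M 1)))) 1) := by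
  haveI : CompactSpace (absoluteGaloisGroup (w.adicCompletion K)) := absoluteGaloisGroup_compactSpace _
  let τX := (GaloisRep.toLocal w (κ.eisensteinTwist (ρ 1) hm 1)).subrepresentation (Φ.twistedFil 1) (Φ.twistedFil_le_comap hm 1)
  let τQ := (GaloisRep.toLocal w ρN).subrepresentation FilN hΓN
  -- the kernel
  let K₀ : Submodule ℤ (Φ.twistedFil (p := p) (m := m) 1) :=
    (LinearMap.ker πbar.toAddMonoidHom.toIntLinearMap).comap (Φ.twistedFil (p := p) (m := m) 1).subtype
  have hK₀ : ∀ x, x ∈ K₀ ↔ πbar (x : EisensteinCoeff.Twisted p m 1 (M 1)) = 0 := fun _ ↦ Iff.rfl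
  have hK₀Γ : ∀ σ : absoluteGaloisGroup (w.adicCompletion K), K₀ ≤ K₀.comap (τX σ) := by
    intro σ x hx
    rw [Submodule.mem_comap, hK₀]
    change πbar (GaloisRep.toLocal w (κ.eisensteinTwist (ρ 1) hm 1) σ (x : EisensteinCoeff.Twisted p m 1 (M 1))) = 0
    rw [GaloisRep.toLocal_apply, hbar.equivariant, (hK₀ x).mp hx, map_zero]
  -- the row `0 → K → A ⊗ Fil → Fil_w T̄ → 0`
  let gP : τX.toTopRep ⟶ τQ.toTopRep := TopRep.ofHom
    ⟨⟨(πbar.toAddMonoidHom.toIntLinearMap.restrict (p := Φ.twistedFil (p := p) (m := m) 1) (q := FilN) hπFil).toAddMonoidHom.toIntLinearMap,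
      continuous_of_discreteTopology⟩,
      fun σ ↦ ContinuousLinearMap.ext fun x ↦ Subtype.ext (hbar.equivariant (absGaloisRestrict K (w.adicCompletion K) σ)
        (x : EisensteinCoeff.Twisted p m 1 (M 1)))⟩
  have hS : IsSES (subtypeHom τX K₀ hK₀Γ) gP :=
    { comp_eq_zero := by
        ext x
        exact ((hK₀ x).mp x.2).trans rfl
      injective := Subtype.val_injective
      exact_mid := fun y hy ↦ ⟨⟨y, (hK₀ y).mpr (congrArg Subtype.val hy)⟩, rfl⟩
      surjective := fun z ↦ by
        obtain ⟨x, hx, hxz⟩ := hπonto z.1 z.2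
        exact ⟨⟨x, hx⟩, Subtype.ext hxz⟩ }
  haveI : Subsingleton (continuousCohomology 2 (τX.subrepresentation K₀ hK₀Γ).toTopRep) :=
    Φ.subsingleton_continuousCohomology_two_ker_restrict κ hm hNmod ρN πbar hbar hpure hFil K₀ hK₀ hK₀Γ
  intro x
  obtain ⟨y, hy⟩ := hS.exists_map_one_eq_of_δ₁_eq_zero x (Subsingleton.elim _ _)
  exact ⟨y, hy⟩

end Literature.NumberTheory.EllipticCurves.ZpExtension.OrdinaryFiltration

/-! ## §3 The curve -/

namespace WeierstrassCurve

open Literature.NumberTheory.EllipticCurves Literature.NumberTheory.GaloisRepresentations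
open Literature.NumberTheory.GaloisRepresentations.DiscreteGaloisModule
open Literature.NumberTheory.GaloisCohomology.Howard2004
open Literature.NumberTheory.EllipticCurves.IwasawaAlgebra Literature.NumberTheory.EllipticCurves.ZpExtension

variable {K : Type} [Field K] [NumberField K] (E : WeierstrassCurve K) [E.IsElliptic] {p : ℕ} [hp : Fact p.Prime]
  (κ : ZpExtension K p) {m : ℕ} (hm : 1 ≤ m) (w : HeightOneSpectrum (𝓞 K))
  [Module (EisensteinCoeff p m 1) (geomTorsion E (p : ℤ))]
  (hN : ∀ (d : EisensteinCoeff p m 1) (n : geomTorsion E (p : ℤ)), d • n = (EisensteinCoeff.residueChar p hm (le_refl 1) d).val • n)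
  (πbar : EisensteinCoeff.Twisted p m 1 (geomTorsion E ((p : ℤ) ^ 1)) →ₗ[EisensteinCoeff p m 1] geomTorsion E (p : ℤ))
  (hbar : IsQuotientBy (κ.eisensteinTwist (E.torsionGaloisModule ((p : ℤ) ^ 1)) hm 1)
    (@IsLocalRing.maximalIdeal _ _ (EisensteinCoeff.isLocalRing_eisensteinCoeff p hm (le_refl 1)))
    (E.torsionGaloisModule (p : ℤ)) πbar)
  (hone : ∀ a : geomTorsion E ((p : ℤ) ^ 1),
    ((πbar (EisensteinCoeff.Twisted.tmul 1 a) : geomTorsion E (p : ℤ)) : geomPoints E) = (a : geomPoints E))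

include hN hone in
/-- **The residual lift for the curve**: at a place `w ∋ p` of good reduction with an ordinary point, if every `Γ_{K_w}`-equivariant
additive map `Fil_w E[p] → μ_p` vanishes (non-anomalous: `Ẽ_w[p]^{Γ_w} = 0`), then
`H¹(K_w, A_{m,1} ⊗ Fil_w E[p]) → H¹(K_w, Fil_w E[p])` (induced by `π̄`, `π̄(1 ⊗ a) = a`) is onto — the binder `hliftbar` of
`ZpExtension.propagate_eisensteinSelmerStructure_one_eq_strictSubgroup` for `T̄ = E[p]`, `Fil_w T̄ = E[p] ∩ E₁(K̄_w)`.
[cite: Howard2004HeegnerKolyvagin, Lemma 3.2.7 and §3.1 (arXiv:1202.6340 p. 16 L150–156, p. 15 L56–66)] [cite: MilneADT2006, Ch. I Cor. 2.3] -/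
theorem surjective_cohomologyMap_restrict_πbar_twistedFil (hpw : (p : 𝓞 K) ∈ w.asIdeal) (hgood : E.HasGoodReductionAt w)
    (hord : ∃ P : localPoints E (w.adicCompletion K), (p : ℤ) • P = 0 ∧ P ∉ E.localKernelOfReduction w)
    (hFil : ∀ g : (E.ordinaryFiltrationAt w (fun j ↦ E.torsionGaloisModuleReduce p j) (fun _ _ ↦ rfl)).fil 1 →+
        MuCarrier (w.adicCompletion K) (p ^ 1),
      (∀ (σ : absoluteGaloisGroup (w.adicCompletion K))
        (a : (E.ordinaryFiltrationAt w (fun j ↦ E.torsionGaloisModuleReduce p j) (fun _ _ ↦ rfl)).fil 1),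
        g ⟨GaloisRep.toLocal w (E.torsionGaloisModule ((p : ℤ) ^ 1)) σ a,
          (E.ordinaryFiltrationAt w (fun j ↦ E.torsionGaloisModuleReduce p j) (fun _ _ ↦ rfl)).smul_mem 1 σ a a.2⟩ =
          mu (w.adicCompletion K) (p ^ 1) σ (g a)) → g = 0) :
    Function.Surjective
      (ContinuousRep.cohomologyMap
        ((GaloisRep.toLocal w (κ.eisensteinTwist (E.torsionGaloisModule ((p : ℤ) ^ 1)) hm 1)).subrepresentation
          ((E.ordinaryFiltrationAt w (fun j ↦ E.torsionGaloisModuleReduce p j) (fun _ _ ↦ rfl)).twistedFil 1)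
          ((E.ordinaryFiltrationAt w (fun j ↦ E.torsionGaloisModuleReduce p j) (fun _ _ ↦ rfl)).twistedFil_le_comap hm 1))
        ((GaloisRep.toLocal w (E.torsionGaloisModule (p : ℤ))).subrepresentation (E.torsionFilAt w (p : ℤ))
          (E.torsionFilAt_le_comap w (p : ℤ)))
        (πbar.toAddMonoidHom.toIntLinearMap.restrict
          (p := (E.ordinaryFiltrationAt w (fun j ↦ E.torsionGaloisModuleReduce p j) (fun _ _ ↦ rfl)).twistedFil (p := p) (m := m) 1)
          (q := E.torsionFilAt w (p : ℤ))
          (fun _ hx ↦ E.πbar_mem_torsionFilAt_of_mem_twistedFil hm w hN πbar hone hx)).toAddMonoidHom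
        continuous_of_discreteTopology
        (fun σ x ↦ Subtype.ext (hbar.equivariant (absGaloisRestrict K (w.adicCompletion K) σ)
          (x : EisensteinCoeff.Twisted p m 1 (geomTorsion E ((p : ℤ) ^ 1))))) 1) := by
  haveI : Finite (geomTorsion E ((p : ℤ) ^ 1)) :=
    finite_torsionPoints_holds E (AlgebraicClosure K) (pow_ne_zero 1 (by exact_mod_cast hp.out.ne_zero))
  exact (E.ordinaryFiltrationAt w (fun j ↦ E.torsionGaloisModuleReduce p j) (fun _ _ ↦ rfl)).surjective_cohomologyMap_restrict_twistedFil_one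
    κ hm hN (E.torsionGaloisModule (p : ℤ)) πbar hbar
    (fun x hx hx0 ↦ E.exists_eq_mk_X_smul_of_πbar_eq_zero κ hm w πbar hbar hpw hgood hord hx hx0) hFil
    (E.torsionFilAt w (p : ℤ)) (E.torsionFilAt_le_comap w (p : ℤ))
    (fun _ hx ↦ E.πbar_mem_torsionFilAt_of_mem_twistedFil hm w hN πbar hone hx)
    (fun _ hy ↦ E.exists_mem_twistedFil_πbar_eq w πbar hone hy)

end WeierstrassCurve

end
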